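import Summits.NavierStokesRegularity.NavierStokesRegularity.Theses.SelfMixingDichotomy
import Literature.Analysis.FluidPDE.DissipatesAtScale
import HarnessLib

/-!
# Route SelfMixingDichotomy — crux `CoherentScaleExclusion` (S2, stmt-NavierStokesRegularity-1423), line `registered`,
# lead c3: the crux is its own `δ → 0` tail

Support file (`--supports stmt-NavierStokesRegularity-1423`). Write `S2(δ)` for the crux at a fixed mixing level `δ`
(`∃ M ∀ (u, p, T, x₀): recurrent M-loaded non-δ-mixing scales at (T, x₀) ⇒ u bounded near (T, x₀)`), so that
`CoherentScaleExclusion = ∀ δ > 0, S2(δ)`. Since `MIX(r, δ) ⇒ MIX(r, δ')` for `δ ≤ δ'` (`DissipatesAtScale.mono`), the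
recurrence hypothesis of `S2(δ')` implies that of `S2(δ)` with the same threshold, hence

* `coherentScaleExclusion_level_mono` — `S2(δ) → S2(δ')` for `0 ≤ δ ≤ δ'`: the crux is ANTITONE in the level, a smaller
  `δ` is a STRONGER statement;
* `coherentScaleExclusion_iff_tail` — `CoherentScaleExclusion ↔ ∀ ε > 0, ∃ δ ∈ (0, ε), S2(δ)`: the crux is equivalent to
  its own tail `δ → 0⁺`. Combined with the tree's results this locates the content exactly: `S2(δ)` is PROVED for
  `δ ≥ δ₀` (`coherentScaleExclusion_of_nashCeiling_le`, drift-independent Nash ceiling), is kinematically false for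
  `δ ≤ δ₁` (the swirl-coherence constant: `stub_coherentTypeIExclusion_false_without_momentum`,
  `stub_coherentCascadeExclusion_false_without_momentum`), and by the present file nothing is gained by proving it on any
  interval bounded away from `0`: every line must handle arbitrarily small `δ`, where `¬ MIX(r, δ)` degenerates to
  "some scale-`r` blob is not completely destroyed" and the statement tends to "no pure-cascade blow-up with `C ≥ M`".
-/

noncomputable section

open Literature.Analysis.FluidPDE MeasureTheory Set Function Metric

-- `Summit = Problem` for this summit; the tree lakefile sets `weak.linter.dupNamespace = false`.
set_option linter.dupNamespace false

namespace Summit.NavierStokesRegularity.NavierStokesRegularity.Theorems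

open Summit.NavierStokesRegularity.NavierStokesRegularity.Theses.SelfMixingDichotomy

/-- **The crux is antitone in the mixing level.** If `S2(δ)` holds (with some threshold `M`) and `0 ≤ δ ≤ δ'`, then
`S2(δ')` holds with the same threshold: a scale that is not `δ'`-mixing is not `δ`-mixing
(`DissipatesAtScale.mono`), so recurrent `M`-loaded non-`δ'`-mixing scales are recurrent `M`-loaded non-`δ`-mixing
scales. The level-`δ` statement is written out (it is the body of `CoherentScaleExclusion` at a fixed `δ`, with
`MIX` spelled `DissipatesAtScale`, definitionally). -/
theorem coherentScaleExclusion_level_mono {δ δ' : ℝ} (hδ : 0 ≤ δ) (hδδ' : δ ≤ δ')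
    (h : ∃ M : ℝ, ∀ T : ℝ, 0 < T →
      ∀ (u : ℝ → EuclideanSpace ℝ (Fin 3) → EuclideanSpace ℝ (Fin 3)) (p : ℝ → EuclideanSpace ℝ (Fin 3) → ℝ),
      IsClassicalNSSolutionOn (Set.Ico 0 T) 1 0 u p → IsLerayHopfOn T 1 0 (u 0) u → HasRapidSpatialDecay (u 0) →
      ∀ x₀ : EuclideanSpace ℝ (Fin 3),
      (∀ r₀ : ℝ, 0 < r₀ → ∃ r ∈ Set.Ioo 0 r₀,
        ENNReal.ofReal M ≤ cknC r ((T, x₀) : ℝ × EuclideanSpace ℝ (Fin 3)) u ∧ ¬ DissipatesAtScale u T x₀ r δ) →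
      ∃ ρ : ℝ, 0 < ρ ∧ ∃ M : ℝ, ∀ t ∈ Set.Ioo (T - ρ ^ 2) T, ∀ x ∈ Metric.ball x₀ ρ, ‖u t x‖ ≤ M) :
    ∃ M : ℝ, ∀ T : ℝ, 0 < T →
      ∀ (u : ℝ → EuclideanSpace ℝ (Fin 3) → EuclideanSpace ℝ (Fin 3)) (p : ℝ → EuclideanSpace ℝ (Fin 3) → ℝ),
      IsClassicalNSSolutionOn (Set.Ico 0 T) 1 0 u p → IsLerayHopfOn T 1 0 (u 0) u → HasRapidSpatialDecay (u 0) →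
      ∀ x₀ : EuclideanSpace ℝ (Fin 3),
      (∀ r₀ : ℝ, 0 < r₀ → ∃ r ∈ Set.Ioo 0 r₀,
        ENNReal.ofReal M ≤ cknC r ((T, x₀) : ℝ × EuclideanSpace ℝ (Fin 3)) u ∧ ¬ DissipatesAtScale u T x₀ r δ') →
      ∃ ρ : ℝ, 0 < ρ ∧ ∃ M : ℝ, ∀ t ∈ Set.Ioo (T - ρ ^ 2) T, ∀ x ∈ Metric.ball x₀ ρ, ‖u t x‖ ≤ M := by
  obtain ⟨M, hM⟩ := h
  refine ⟨M, fun T hT u p hcl hLH hdec x₀ hRec => hM T hT u p hcl hLH hdec x₀ fun r₀ hr₀ => ?_⟩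
  obtain ⟨r, hr, hload, hnot⟩ := hRec r₀ hr₀
  exact ⟨r, hr, hload, fun hmix => hnot (hmix.mono hδ hδδ')⟩

/-- **The crux is equivalent to its own `δ → 0⁺` tail**: `CoherentScaleExclusion ↔ ∀ ε > 0, ∃ δ ∈ (0, ε), S2(δ)`.
(`→`: take `δ = ε/2`; `←`: given `δ₀ > 0`, pick `δ ∈ (0, δ₀)` with `S2(δ)` and raise the level by
`coherentScaleExclusion_level_mono`.) Hence no interval of levels bounded away from `0` carries the crux. -/
theorem coherentScaleExclusion_iff_tail :
    CoherentScaleExclusion ↔ ∀ ε : ℝ, 0 < ε → ∃ δ : ℝ, 0 < δ ∧ δ < ε ∧ ∃ M : ℝ, ∀ T : ℝ, 0 < T →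
      ∀ (u : ℝ → EuclideanSpace ℝ (Fin 3) → EuclideanSpace ℝ (Fin 3)) (p : ℝ → EuclideanSpace ℝ (Fin 3) → ℝ),
      IsClassicalNSSolutionOn (Set.Ico 0 T) 1 0 u p → IsLerayHopfOn T 1 0 (u 0) u → HasRapidSpatialDecay (u 0) →
      ∀ x₀ : EuclideanSpace ℝ (Fin 3),
      (∀ r₀ : ℝ, 0 < r₀ → ∃ r ∈ Set.Ioo 0 r₀,
        ENNReal.ofReal M ≤ cknC r ((T, x₀) : ℝ × EuclideanSpace ℝ (Fin 3)) u ∧ ¬ DissipatesAtScale u T x₀ r δ) →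
      ∃ ρ : ℝ, 0 < ρ ∧ ∃ M : ℝ, ∀ t ∈ Set.Ioo (T - ρ ^ 2) T, ∀ x ∈ Metric.ball x₀ ρ, ‖u t x‖ ≤ M := by
  constructor
  · intro h ε hε
    exact ⟨ε / 2, by positivity, by linarith, h (ε / 2) (by positivity)⟩
  · intro h δ' hδ'
    obtain ⟨δ, hδ, hδlt, hS⟩ := h δ' hδ'
    exact coherentScaleExclusion_level_mono hδ.le hδlt.le hS

end Summit.NavierStokesRegularity.NavierStokesRegularity.Theorems

end
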